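import Summits.NavierStokesRegularity.NavierStokesRegularity.Theses.RellichScar
import Summits.NavierStokesRegularity.NavierStokesRegularity.Theorems.SymmetricScarExists.Negative.SpiralWorld
import Summits.NavierStokesRegularity.NavierStokesRegularity.Theorems.RellichScarScarRigidityApexBounds
import Summits.NavierStokesRegularity.NavierStokesRegularity.Theorems.RellichScarScarRigidityApexBoundsFar
import Summits.NavierStokesRegularity.NavierStokesRegularity.Theorems.RellichScarScarRigidityFarFieldAllOrders
import Literature.Analysis.FluidPDE.TypeIAncientMild

/-!
# `SymmetricScarExists` — line `analytic-scar-window-rigidity`, stub `stub_apexScarTrace`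
# (crux stmt-NavierStokesRegularity-11718, route RellichScar)

**The scar of an apex profile as an honest function.** A Type-I ancient mild field `V` in the
Oseen gauge (`IsTypeIAncientMild C V`) with the apex bound `HasTypeIDecay C V` has a final-time
trace off the origin, `σ(x) = lim_{t ↑ 0} V(t, x)` (`x ≠ 0`), with ONE constant `L = L(C)` for the
whole class:

* the rate `‖V(t, x) − σ(x)‖ ≤ L(−t)/‖x‖³` (`t < 0`, `x ≠ 0`);
* the bound `‖σ(x)‖ ≤ C/‖x‖` (`x ≠ 0`);
* the local Lipschitz bound `‖σ(y) − σ(x)‖ ≤ (L/‖x‖²)·dist(y, x)` on `closedBall x (‖x‖/2)`.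

Proof (elementary from the landed S1β bounds, `Theorems/RellichScarScarRigidityApexBounds*.lean`).
The time derivative obeys `‖∂ₜV(t, x)‖ ≤ L₂/(‖x‖+√(−t))³ ≤ L₂/‖x‖³` (`exists_norm_deriv_le_apex`,
for the glued classical pressure of `exists_isClassicalNSSolutionOn_Iio`), so `s ↦ V(s, x)` is
`(L₂/‖x‖³)`-Lipschitz on `s < 0` (mean value inequality), hence Cauchy as `s ↑ 0`; completeness
gives `σ(x)`, and letting `s ↑ 0` in `‖V(t,x) − V(s,x)‖ ≤ (L₂/‖x‖³)|t − s|` gives the rate.  The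
bound `‖σ‖ ≤ C/‖x‖` is the limit of the apex bound.  The gradient bound
`‖∇V(t, z)‖ ≤ L₁/(‖z‖+√(−t))² ≤ 4L₁/‖x‖²` on `closedBall x (‖x‖/2)` (where `‖z‖ ≥ ‖x‖/2`;
`exists_norm_iteratedFDeriv_le_apex` with `n = 1`) and the mean value inequality on this convex
ball give `‖V(t,y) − V(t,x)‖ ≤ (4L₁/‖x‖²) dist(y,x)` for every `t < 0`; let `t ↑ 0`.  One takes
`L = max(L₂, 4L₁)`.  At `x = 0` no claim is made (`σ 0` is the same `limUnder` formula, a junk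
value there).

References: Koch–Nadirashvili–Seregin–Šverák 2009, Prop. 4.1 (arXiv:0709.3599v1 p. 8);
Seregin–Šverák 2009, §2 p. 8 (the a priori derivative bounds behind S1β).
-/

noncomputable section

open MeasureTheory Set Function Filter Topology TopologicalSpace Metric
open scoped NNReal ENNReal

namespace Summit.NavierStokesRegularity.NavierStokesRegularity.Theorems.SymmetricScarExists.ScarWindow

open Literature.Analysis.FluidPDE
open Summit.NavierStokesRegularity.NavierStokesRegularity.Theses.RellichScar
open Summit.NavierStokesRegularity.NavierStokesRegularity.Theorems.SymmetricScarExists.Negative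
open Summit.NavierStokesRegularity.NavierStokesRegularity.Theorems.RellichScarScarRigidity
  (exists_norm_deriv_le_apex exists_norm_iteratedFDeriv_le_apex exists_isClassicalNSSolutionOn_Iio
    norm_le_div_norm_of_hasTypeIDecay uniformCauchySeqOn_nhdsLT_of_lipschitz)

set_option linter.dupNamespace false

/-! ## Time lines off the apex: Lipschitz, Cauchy, limit, rate -/

section TimeLines

variable {V : ℝ → EuclideanSpace ℝ (Fin 3) → EuclideanSpace ℝ (Fin 3)} {L : ℝ}

/-- **Mean value inequality in time.** For a field jointly smooth on the open backward slab with
`‖∂ₜV(t, x)‖ ≤ L/(‖x‖+√(−t))³`, the time line `s ↦ V(s, x)` (`x ≠ 0`) is `(L/‖x‖³)`-Lipschitz on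
`s < 0` (Mathlib `Convex.norm_image_sub_le_of_norm_deriv_le` on `Iio 0`). [folklore] -/
theorem norm_sub_sub_le_of_deriv_apex (hV : IsSmoothSpaceTimeOn (Iio (0 : ℝ)) V) (hL : 0 ≤ L)
    (hd : ∀ t < 0, ∀ x : EuclideanSpace ℝ (Fin 3),
      ‖deriv (fun s => V s x) t‖ ≤ L / (‖x‖ + Real.sqrt (-t)) ^ 3)
    {x : EuclideanSpace ℝ (Fin 3)} (hx : x ≠ 0) {s t : ℝ} (hs : s < 0) (ht : t < 0) :
    ‖V t x - V s x‖ ≤ L / ‖x‖ ^ 3 * |t - s| := by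
  have hxpos : 0 < ‖x‖ := norm_pos_iff.2 hx
  have hdiff : ∀ τ ∈ Iio (0 : ℝ), DifferentiableAt ℝ (fun σ => V σ x) τ := fun τ hτ =>
    (hV.differentiableWithinAt_time hτ x).differentiableAt (Iio_mem_nhds hτ)
  have hbound : ∀ τ ∈ Iio (0 : ℝ), ‖deriv (fun σ => V σ x) τ‖ ≤ L / ‖x‖ ^ 3 := by
    intro τ hτ
    have hτ' : τ < 0 := hτ
    refine (hd τ hτ' x).trans ?_
    exact div_le_div_of_nonneg_left hL (pow_pos hxpos 3)
      (pow_le_pow_left₀ hxpos.le (le_add_of_nonneg_right (Real.sqrt_nonneg _)) 3)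
  have h := (convex_Iio (0 : ℝ)).norm_image_sub_le_of_norm_deriv_le hdiff hbound hs ht
  rwa [Real.norm_eq_abs] at h

/-- **The time lines converge.** Under the same bound, `V(s, x)` has a limit as `s ↑ 0` for
`x ≠ 0` (Lipschitz in `s` ⇒ Cauchy along `𝓝[<] 0` ⇒ convergent by completeness), namely
`limUnder (𝓝[<] 0) (V · x)`. [folklore] -/
theorem tendsto_limUnder_of_deriv_apex (hV : IsSmoothSpaceTimeOn (Iio (0 : ℝ)) V) (hL : 0 ≤ L)
    (hd : ∀ t < 0, ∀ x : EuclideanSpace ℝ (Fin 3),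
      ‖deriv (fun s => V s x) t‖ ≤ L / (‖x‖ + Real.sqrt (-t)) ^ 3)
    {x : EuclideanSpace ℝ (Fin 3)} (hx : x ≠ 0) :
    Tendsto (fun s => V s x) (𝓝[<] (0 : ℝ)) (𝓝 (limUnder (𝓝[<] (0 : ℝ)) (fun s => V s x))) := by
  have hC : UniformCauchySeqOn V (𝓝[<] (0 : ℝ)) {x} :=
    uniformCauchySeqOn_nhdsLT_of_lipschitz (F := V) (U := ({x} : Set (EuclideanSpace ℝ (Fin 3))))
      (M := L / ‖x‖ ^ 3) (div_nonneg hL (pow_nonneg (norm_nonneg _) 3))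
      fun y hy s hs t ht => by
        rw [mem_singleton_iff.1 hy]
        exact norm_sub_sub_le_of_deriv_apex hV hL hd hx hs ht
  exact tendsto_nhds_limUnder (cauchy_map_iff_exists_tendsto.1 (hC.cauchy_map (mem_singleton x)))

/-- **The rate.** Under the same bound, `‖V(t, x) − σ(x)‖ ≤ (L/‖x‖³)(−t)` for `t < 0`, `x ≠ 0`,
where `σ(x)` is the limit of `V(s, x)` as `s ↑ 0` (let `s ↑ 0` in the Lipschitz bound,
`|t − s| ≤ −t` for `s ∈ (t, 0)`). [folklore] -/
theorem norm_sub_lim_le_of_deriv_apex (hV : IsSmoothSpaceTimeOn (Iio (0 : ℝ)) V) (hL : 0 ≤ L)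
    (hd : ∀ t < 0, ∀ x : EuclideanSpace ℝ (Fin 3),
      ‖deriv (fun s => V s x) t‖ ≤ L / (‖x‖ + Real.sqrt (-t)) ^ 3)
    {x : EuclideanSpace ℝ (Fin 3)} (hx : x ≠ 0) {σx : EuclideanSpace ℝ (Fin 3)}
    (hσ : Tendsto (fun s => V s x) (𝓝[<] (0 : ℝ)) (𝓝 σx)) {t : ℝ} (ht : t < 0) :
    ‖V t x - σx‖ ≤ L / ‖x‖ ^ 3 * (-t) := by
  have hM0 : 0 ≤ L / ‖x‖ ^ 3 := div_nonneg hL (pow_nonneg (norm_nonneg _) 3)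
  have hev : ∀ᶠ s in 𝓝[<] (0 : ℝ), ‖V t x - V s x‖ ≤ L / ‖x‖ ^ 3 * (-t) := by
    filter_upwards [Ioo_mem_nhdsLT ht] with s hs
    have habs : |t - s| ≤ -t := by
      rw [abs_of_nonpos (by linarith [hs.1])]
      linarith [hs.2]
    exact (norm_sub_sub_le_of_deriv_apex hV hL hd hx hs.2 ht).trans
      (mul_le_mul_of_nonneg_left habs hM0)
  exact le_of_tendsto (tendsto_const_nhds.sub hσ).norm hev

end TimeLines

/-! ## Spatial Lipschitz bound on the half ball -/

/-- **Mean value inequality in space.** For a `C¹` slice with `‖∇f(z)‖ ≤ L₁/(‖z‖+ρ)²` (`ρ ≥ 0`)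
and `x ≠ 0`, on the convex ball `closedBall x (‖x‖/2)` (where `‖z‖ ≥ ‖x‖/2`) one has
`‖f(y) − f(x)‖ ≤ (4L₁/‖x‖²)·dist(y, x)` (Mathlib `Convex.norm_image_sub_le_of_norm_fderiv_le`).
[folklore] -/
theorem norm_sub_le_of_fderiv_apex {f : EuclideanSpace ℝ (Fin 3) → EuclideanSpace ℝ (Fin 3)}
    (hf : Differentiable ℝ f) {L₁ ρ : ℝ} (hL₁ : 0 ≤ L₁) (hρ : 0 ≤ ρ)
    (hd : ∀ z : EuclideanSpace ℝ (Fin 3), ‖fderiv ℝ f z‖ ≤ L₁ / (‖z‖ + ρ) ^ 2)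
    {x y : EuclideanSpace ℝ (Fin 3)} (hx : x ≠ 0) (hy : dist y x ≤ ‖x‖ / 2) :
    ‖f y - f x‖ ≤ 4 * L₁ / ‖x‖ ^ 2 * dist y x := by
  have hxpos : 0 < ‖x‖ := norm_pos_iff.2 hx
  have hbound : ∀ z ∈ closedBall x (‖x‖ / 2), ‖fderiv ℝ f z‖ ≤ 4 * L₁ / ‖x‖ ^ 2 := by
    intro z hz
    -- points of the half ball have norm at least `‖x‖/2`
    have hz' : ‖x‖ / 2 ≤ ‖z‖ := by
      rw [mem_closedBall, dist_eq_norm, norm_sub_rev] at hz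
      have h1 : ‖x‖ - ‖z‖ ≤ ‖x - z‖ := norm_sub_norm_le x z
      linarith
    have hpow : (‖x‖ / 2) ^ 2 ≤ (‖z‖ + ρ) ^ 2 :=
      pow_le_pow_left₀ (half_pos hxpos).le (hz'.trans (le_add_of_nonneg_right hρ)) 2
    calc ‖fderiv ℝ f z‖ ≤ L₁ / (‖z‖ + ρ) ^ 2 := hd z
      _ ≤ L₁ / (‖x‖ / 2) ^ 2 := div_le_div_of_nonneg_left hL₁ (pow_pos (half_pos hxpos) 2) hpow
      _ = 4 * L₁ / ‖x‖ ^ 2 := by field_simp; ring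
  have h := (convex_closedBall x (‖x‖ / 2)).norm_image_sub_le_of_norm_fderiv_le
    (fun z _ => hf z) hbound (mem_closedBall_self (half_pos hxpos).le) (mem_closedBall.2 hy)
  rwa [← dist_eq_norm] at h

/-! ## The registered stub -/

/-- **Registered stub `stub_apexScarTrace`** (line `analytic-scar-window-rigidity` of crux
stmt-NavierStokesRegularity-11718).  A Type-I ancient mild field with the apex bound of constant
`C > 0` has a SCAR: a field `σ` on `ℝ³` with `‖V(t,x) − σ(x)‖ ≤ L(−t)/‖x‖³` (`t < 0`, `x ≠ 0`),
`‖σ(x)‖ ≤ C/‖x‖`, and `‖σ(y) − σ(x)‖ ≤ (L/‖x‖²)·dist(y,x)` on `closedBall x (‖x‖/2)` — with ONE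
constant `L = L(C)` for the whole class (`L = max(L₂, 4L₁)` from the S1β bounds
`‖∂ₜV‖ ≤ L₂/(‖x‖+√−t)³`, `‖∇V‖ ≤ L₁/(‖x‖+√−t)²`).
[cite: KochNadirashviliSereginSverak2009, Prop. 4.1 (arXiv:0709.3599v1 p. 8)] -/
theorem stub_apexScarTrace :
    ∀ C : ℝ, 0 < C → ∃ L : ℝ, 0 ≤ L ∧ ∀ V : ℝ → EuclideanSpace ℝ (Fin 3) → EuclideanSpace ℝ (Fin 3), IsTypeIAncientMild C V → HasTypeIDecay C V →
      ∃ σ : EuclideanSpace ℝ (Fin 3) → EuclideanSpace ℝ (Fin 3),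
        (∀ t : ℝ, t < 0 → ∀ x : EuclideanSpace ℝ (Fin 3), x ≠ 0 → ‖V t x - σ x‖ ≤ L * (-t) / ‖x‖ ^ 3) ∧
        (∀ x : EuclideanSpace ℝ (Fin 3), x ≠ 0 → ‖σ x‖ ≤ C / ‖x‖) ∧
        (∀ x y : EuclideanSpace ℝ (Fin 3), x ≠ 0 → dist y x ≤ ‖x‖ / 2 → ‖σ y - σ x‖ ≤ L / ‖x‖ ^ 2 * dist y x) := by
  intro C hC
  obtain ⟨L₁, hL₁0, hL₁⟩ := exists_norm_iteratedFDeriv_le_apex C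
  obtain ⟨L₂, hL₂0, hL₂⟩ := exists_norm_deriv_le_apex C
  refine ⟨max L₂ (4 * L₁), hL₂0.trans (le_max_left _ _), fun V hV hd => ?_⟩
  obtain ⟨Q, hQ⟩ := exists_isClassicalNSSolutionOn_Iio hV
  have hVs : IsSmoothSpaceTimeOn (Iio (0 : ℝ)) V := hV.contDiffOn
  have hdt : ∀ t < 0, ∀ x : EuclideanSpace ℝ (Fin 3),
      ‖deriv (fun s => V s x) t‖ ≤ L₂ / (‖x‖ + Real.sqrt (-t)) ^ 3 :=
    hL₂ hV hd hQ
  -- the scar: the limit of the time lines (junk at `x = 0`, where nothing is claimed)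
  refine ⟨fun x => limUnder (𝓝[<] (0 : ℝ)) (fun s => V s x), fun t ht x hx => ?_, fun x hx => ?_,
    fun x y hx hy => ?_⟩
  · -- the rate
    have h := norm_sub_lim_le_of_deriv_apex hVs hL₂0 hdt hx
      (tendsto_limUnder_of_deriv_apex hVs hL₂0 hdt hx) ht
    refine h.trans ?_
    rw [div_mul_eq_mul_div]
    exact div_le_div_of_nonneg_right
      (mul_le_mul_of_nonneg_right (le_max_left _ _) (neg_nonneg.2 ht.le))
      (pow_nonneg (norm_nonneg _) 3)
  · -- the apex bound passes to the limit
    refine le_of_tendsto (tendsto_limUnder_of_deriv_apex hVs hL₂0 hdt hx).norm ?_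
    filter_upwards [self_mem_nhdsWithin] with s hs
    exact norm_le_div_norm_of_hasTypeIDecay hd hC.le hs hx
  · -- the spatial Lipschitz bound passes to the limit
    have hxpos : 0 < ‖x‖ := norm_pos_iff.2 hx
    have hy0 : y ≠ 0 := by
      intro h0
      rw [h0, dist_eq_norm, zero_sub, norm_neg] at hy
      linarith
    have hlim : Tendsto (fun s => V s y - V s x) (𝓝[<] (0 : ℝ))
        (𝓝 (limUnder (𝓝[<] (0 : ℝ)) (fun s => V s y) -
          limUnder (𝓝[<] (0 : ℝ)) (fun s => V s x))) :=
      (tendsto_limUnder_of_deriv_apex hVs hL₂0 hdt hy0).sub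
        (tendsto_limUnder_of_deriv_apex hVs hL₂0 hdt hx)
    refine le_of_tendsto hlim.norm ?_
    filter_upwards [self_mem_nhdsWithin] with s hs
    have hs' : s < 0 := hs
    have hdiff : Differentiable ℝ (V s) := (hV.contDiff_slice hs').differentiable (by simp)
    have hgrad : ∀ z : EuclideanSpace ℝ (Fin 3),
        ‖fderiv ℝ (V s) z‖ ≤ L₁ / (‖z‖ + Real.sqrt (-s)) ^ 2 := by
      intro z
      have h1 := hL₁ hV hd 1 (by norm_num) s hs' z
      rwa [norm_iteratedFDeriv_one] at h1
    calc ‖V s y - V s x‖ ≤ 4 * L₁ / ‖x‖ ^ 2 * dist y x :=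
          norm_sub_le_of_fderiv_apex hdiff hL₁0 (Real.sqrt_nonneg _) hgrad hx hy
      _ ≤ max L₂ (4 * L₁) / ‖x‖ ^ 2 * dist y x :=
          mul_le_mul_of_nonneg_right (div_le_div_of_nonneg_right (le_max_right _ _)
            (pow_nonneg (norm_nonneg _) 2)) dist_nonneg

end Summit.NavierStokesRegularity.NavierStokesRegularity.Theorems.SymmetricScarExists.ScarWindow

end
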